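import Mathlib
import Literature.NumberTheory.Automorphic.HilbertModularFormQExpansion
import Summits.Langlands.Langlands.Theorems.CapacityClassicalityHilbertIntegralOverconvergentIsCongruenceStubQIndexEncodingTrace
import Summits.Langlands.Langlands.Theorems.CapacityClassicalityHilbertIntegralOverconvergentIsCongruenceEngineInstanceData

/-!
# Admissible encodings of Hilbert `q`-expansions in EXACTLY `[F:ℚ]` variables
# (line `Sketch-ideate-r1-k1`, § T, crux stmt-Langlands-8485)

The end-to-end assembly `hilbertClassicalityModuloNamedFacts` is stated for any admissible encoding `(d, idx, α, enc)`; its named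
fact (ii) asks for `d + 1` forms with independent monomials, which is only satisfiable for `d ≤ [F:ℚ]` (the Hilbert modular variety
has dimension `[F:ℚ]`), and the Siegel count is sharp exactly at `d = [F:ℚ]`.  This file re-runs the landed trace-basis encoding
`stub_qIndex_encoding_trace` with the number of variables PINNED to `Module.finrank ℚ F` (`hcm_qIndex_encoding_trace_finrank`, same
proof) and packages the admissible data with `d = [F:ℚ]` (`hcm_admissible_exists_finrank`), so that the planner can type named fact
(ii) over `Fin ([F:ℚ] + 1)`.
-/

set_option linter.dupNamespace false

noncomputable section

namespace Summit.Langlands.Langlands.Theorems.HilbertIntegralOverconvergentIsCongruence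

open NumberField
open Literature.NumberTheory.Automorphic Literature.NumberTheory.Automorphic.HilbertModular

/-- **The trace-basis encoding in `[F:ℚ]` variables** (the landed R1 `stub_qIndex_encoding_trace` with `d = finrank ℚ F` exposed):
`idx ν := (⌊Tr(β_j ν)⌋)_j` for a `ℚ`-basis `β` of totally positive algebraic integers is injective and additive on the cone, with total
degree `Tr(αν)`, `α := ∑_j β_j ≫ 0`. [folklore] -/
theorem hcm_qIndex_encoding_trace_finrank (F : Type) [Field F] [NumberField F] [NumberField.IsTotallyReal F] :
    ∃ (idx : F → (Fin (Module.finrank ℚ F) →₀ ℕ)) (α : 𝓞 F), (∀ σ : F →+* ℝ, 0 < σ (α : F)) ∧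
      Set.InjOn idx (qIndexSet F) ∧
      (∀ μ ∈ qIndexSet F, ∀ μ' ∈ qIndexSet F, idx (μ + μ') = idx μ + idx μ') ∧
      ∀ ν ∈ qIndexSet F, ((∑ j, idx ν j : ℕ) : ℚ) = Algebra.trace ℚ F ((α : F) * ν) := by
  classical
  obtain ⟨β, hli, hpos⟩ := stub_exists_totallyPositive_integralBasis F
  haveI : Nonempty (Fin (Module.finrank ℚ F)) := ⟨⟨0, Module.finrank_pos⟩⟩
  refine ⟨fun μ ↦ Finsupp.equivFunOnFinite.symm fun j ↦ ⌊Algebra.trace ℚ F ((β j : F) * μ)⌋.toNat, ∑ j, β j,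
    ect_sum_totallyPositive F β hpos, ?_, ?_, ?_⟩
  · intro μ hμ μ' hμ' h
    refine stub_traceEncodingInjective F (fun j ↦ (β j : F)) hli rfl (funext fun j ↦ ?_)
    have hj := congrArg (fun f : Fin (Module.finrank ℚ F) →₀ ℕ ↦ ((f j : ℕ) : ℚ)) h
    simp only [Finsupp.coe_equivFunOnFinite_symm] at hj
    rwa [enc_cast_idx F hμ (β j) (hpos j), enc_cast_idx F hμ' (β j) (hpos j)] at hj
  · intro μ hμ μ' hμ'
    ext j
    apply Nat.cast_injective (R := ℚ)
    simp only [Finsupp.add_apply, Finsupp.coe_equivFunOnFinite_symm, Nat.cast_add]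
    rw [enc_cast_idx F hμ (β j) (hpos j), enc_cast_idx F hμ' (β j) (hpos j),
      enc_cast_idx F (enc_add_mem_qIndexSet F hμ hμ') (β j) (hpos j), mul_add, map_add]
  · intro ν hν
    simp only [Finsupp.coe_equivFunOnFinite_symm]
    exact ect_sum_idx_eq_trace F β hpos hν

/-- **Admissible encodings with `d = [F:ℚ]` exist**: the six admissibility clauses of `hilbertClassicalityModuloNamedFacts` hold for the
trace-basis encoding in `[F:ℚ]` variables and the encoding `enc` of `eid_qexpRing_of_dict` along it. [folklore] -/
theorem hcm_admissible_exists_finrank (F : Type) [Field F] [NumberField F] [NumberField.IsTotallyReal F]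
    (hd : 1 < Module.finrank ℚ F) (𝔫 : Ideal (𝓞 F)) (h𝔫 : 𝔫 ≠ ⊥) :
    ∃ (idx : F → (Fin (Module.finrank ℚ F) →₀ ℕ)) (α : F)
      (enc : (Point F → ℂ) → MvPowerSeries (Fin (Module.finrank ℚ F)) ℂ),
      1 ≤ Module.finrank ℚ F ∧ (∀ σ : F →+* ℝ, 0 < σ α) ∧ Set.InjOn idx (qIndexSet F) ∧
      (∀ μ ∈ qIndexSet F, ∀ μ' ∈ qIndexSet F, idx (μ + μ') = idx μ + idx μ') ∧
      (∀ ν ∈ qIndexSet F, ((∑ j, idx ν j : ℕ) : ℚ) = Algebra.trace ℚ F (α * ν)) ∧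
      ∀ f : Point F → ℂ, (∀ μ ∈ qIndexSet F, MvPowerSeries.coeff (idx μ) (enc f) = fourierCoeff f μ) ∧
        ∀ n, (∀ μ ∈ qIndexSet F, idx μ ≠ n) → MvPowerSeries.coeff n (enc f) = 0 := by
  obtain ⟨idx, α, hα, hinj, hadd, htrace⟩ := hcm_qIndex_encoding_trace_finrank F
  obtain ⟨enc, henc, -⟩ := eid_qexpRing_of_dict F hd 𝔫 h𝔫 _ idx hinj hadd (eid_dict_of_idx F _ idx hinj hadd)
  exact ⟨idx, (α : F), enc, Module.finrank_pos, hα, hinj, hadd, htrace, henc⟩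

end Summit.Langlands.Langlands.Theorems.HilbertIntegralOverconvergentIsCongruence

end
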